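import Literature.Geometry.Riemannian.MetricFlowConcentration
import Mathlib.MeasureTheory.Measure.Prokhorov
import Mathlib.MeasureTheory.Measure.HasOuterApproxClosed
import Mathlib.Topology.Metrizable.Urysohn
import HarnessLib

/-!
# COMPACTNESS OF COUPLINGS: closed integral constraints that hold along a sequence of couplings of two fixed probability measures on a compact
# metrisable space hold for a single coupling (Prokhorov: `ProbabilityMeasure (X × X)` is compact)

Seat `ym-line-csu-p1` (g43), route `ColdStartUniversality` of `Summits/QuantumFields/YangMills`, GENERIC helper file (`--supports stmt-QuantumFields-24809`).
If for every `n` there is a coupling `π_n` of `ν, μ` with `∫ c_m dπ_n ≤ K` for all `m ≤ n` (`c_m` continuous costs on `X × X`), then ONE coupling `π` satisfies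
`∫ c_m dπ ≤ K` for every `m`: a cluster point of `(π_n)` in the compact space of probability measures (Mathlib's `instCompactSpaceProbabilityMeasure`); the
marginal constraints and the integral constraints are closed for the topology of weak convergence (marginals are identified by testing against bounded
continuous functions, `ext_of_forall_lintegral_eq_of_IsFiniteMeasure`, after metrising `X` by Urysohn).  Intended use: simultaneous (window-uniform) transport
bounds, e.g. assembling Talagrand's inequality for the extended metric `ρ_∞` from its window versions; also existence of optimal couplings for suprema of
continuous costs.
* ★★★ `exists_isCoupling_forall_integral_le`.
THEOREMS ONLY, no definition, no sorry.  HONEST FRAMING: generic measure theory; nothing about Yang–Mills is proved here; the Yang–Mills mass gap is NOT proved.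
-/

set_option autoImplicit false

noncomputable section

namespace Summit.QuantumFields.YangMills.Theorems.ColdStartUniversality

open MeasureTheory Filter Topology Set BoundedContinuousFunction
open scoped NNReal ENNReal

/-- ★★★ **Couplings with countably many closed integral constraints.**  Let `X` be compact, Hausdorff and second countable (hence metrisable), `ν, μ` Borel
probability measures on `X`, `c_m : C(X × X, ℝ)` and `K : ℝ`.  If for every `n` some coupling `π_n` of `ν, μ` has `∫ c_m dπ_n ≤ K` for all `m ≤ n`, then some
coupling `π` of `ν, μ` has `∫ c_m dπ ≤ K` for all `m` (a weak cluster point of `(π_n)`; Prokhorov compactness). [folklore] -/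
theorem exists_isCoupling_forall_integral_le {X : Type*} [TopologicalSpace X] [CompactSpace X] [T2Space X] [SecondCountableTopology X]
    [MeasurableSpace X] [BorelSpace X]
    (ν μ : Measure X) [IsProbabilityMeasure ν] [IsProbabilityMeasure μ]
    (c : ℕ → C(X × X, ℝ)) (K : ℝ)
    (h : ∀ n, ∃ π : Measure (X × X), Literature.Geometry.Riemannian.IsCoupling ν μ π ∧ ∀ m ≤ n, ∫ z, c m z ∂π ≤ K) :
    ∃ π : Measure (X × X), Literature.Geometry.Riemannian.IsCoupling ν μ π ∧ ∀ m, ∫ z, c m z ∂π ≤ K := by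
  classical
  letI : MetricSpace X := TopologicalSpace.metrizableSpaceMetric X
  choose π hπ hle using h
  haveI : ∀ n, IsProbabilityMeasure (π n) := fun n => (hπ n).1
  let P : ℕ → ProbabilityMeasure (X × X) := fun n => ⟨π n, inferInstance⟩
  have hPcoe : ∀ n, ((P n : ProbabilityMeasure (X × X)) : Measure (X × X)) = π n := fun n => rfl
  -- a cluster point of the sequence
  obtain ⟨P₀, -, hP₀⟩ := (isCompact_univ (X := ProbabilityMeasure (X × X))).exists_clusterPt
    (f := Filter.map P atTop) (le_principal_iff.2 univ_mem)
  -- closed conditions holding eventually pass to the cluster point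
  have hclosed : ∀ (F : Set (ProbabilityMeasure (X × X))), IsClosed F → ∀ m : ℕ, (∀ n, m ≤ n → P n ∈ F) → P₀ ∈ F := by
    intro F hF m hmem
    have h1 : Filter.map P atTop ≤ 𝓟 (P '' Set.Ici m) := Filter.le_principal_iff.2 (Filter.image_mem_map (Filter.mem_atTop m))
    have h2 : P₀ ∈ closure (P '' Set.Ici m) := mem_closure_iff_clusterPt.2 (hP₀.mono h1)
    refine hF.closure_subset_iff.2 ?_ h2
    rintro _ ⟨n, hn, rfl⟩
    exact hmem n hn
  refine ⟨(P₀ : Measure (X × X)), ⟨inferInstance, ?_, ?_⟩, fun m => ?_⟩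
  · -- first marginal
    refine ext_of_forall_lintegral_eq_of_IsFiniteMeasure fun f => ?_
    have hF : IsClosed {Q : ProbabilityMeasure (X × X) | ∫⁻ z, f z.1 ∂(Q : Measure (X × X)) = ∫⁻ x, f x ∂ν} :=
      isClosed_eq (ProbabilityMeasure.continuous_lintegral_boundedContinuousFunction (f.compContinuous ⟨Prod.fst, continuous_fst⟩)) continuous_const
    have hmem := hclosed _ hF 0 fun n _ => by
      show ∫⁻ z, f z.1 ∂(π n) = ∫⁻ x, f x ∂ν
      rw [← (hπ n).2.1, Measure.fst, lintegral_map f.continuous.measurable.coe_nnreal_ennreal measurable_fst]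
    rw [Measure.fst, lintegral_map f.continuous.measurable.coe_nnreal_ennreal measurable_fst]
    exact hmem
  · refine ext_of_forall_lintegral_eq_of_IsFiniteMeasure fun f => ?_
    have hF : IsClosed {Q : ProbabilityMeasure (X × X) | ∫⁻ z, f z.2 ∂(Q : Measure (X × X)) = ∫⁻ x, f x ∂μ} :=
      isClosed_eq (ProbabilityMeasure.continuous_lintegral_boundedContinuousFunction (f.compContinuous ⟨Prod.snd, continuous_snd⟩)) continuous_const
    have hmem := hclosed _ hF 0 fun n _ => by
      show ∫⁻ z, f z.2 ∂(π n) = ∫⁻ x, f x ∂μ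
      rw [← (hπ n).2.2, Measure.snd, lintegral_map f.continuous.measurable.coe_nnreal_ennreal measurable_snd]
    rw [Measure.snd, lintegral_map f.continuous.measurable.coe_nnreal_ennreal measurable_snd]
    exact hmem
  · have hF : IsClosed {Q : ProbabilityMeasure (X × X) | ∫ z, c m z ∂(Q : Measure (X × X)) ≤ K} :=
      isClosed_le (ProbabilityMeasure.continuous_integral_continuousMap (c m)) continuous_const
    exact hclosed _ hF m fun n hn => hle n m hn

end Summit.QuantumFields.YangMills.Theorems.ColdStartUniversality
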